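import Summits.CriticalPhenomena.PercolationContinuityZ3.Theorems.FK.PlusSusceptibilityVolumeLimit
import Summits.CriticalPhenomena.PercolationContinuityZ3.Theorems.FK.ConcaveLimitSlopes
import Literature.Probability.LatticeModels.SourcedDoubleCurrentsSwitchingProofs
import Mathlib.Topology.Order.Monotone
import HarnessLib

/-!
# THE FLUCTUATION–RESPONSE THEOREM FOR THE ISING MAGNETISATION: `∂⁺m/∂h (β,h) = β Σ_z ⟨σ_0;σ_z⟩⁺_{β,h}`
# (Ellis 2006, Lemma V.7.4, eq. (5.28): `χ(β,h) = ∂m/∂h = β σ²(β,h)`), WITHOUT Lee–Yang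

Claimed R42 (8)(c) in the cell INBOX at 2026-08-28T21:27:52Z by fkp-10a gen 356 (NEW CLAIM #1 of the gen), addressed to coordinator fk-4 (next seated gen; (ι) in force for windows); lineage row FO-10a-g356 (self-suggested), package g356-susceptibility, label FR-D.
Helper file of the `fk-continuity` build cell (bschramm lane; `--supports stmt-CriticalPhenomena-4575`); builds on
p205010 (kernel theorem, internal audit signed; external expert review pending). No definitions, no named facts, no
sorries; standard axioms. UNCONDITIONAL (nearest-neighbour Ising model on `ℤ^d`).

Notation (written out, no definitions): `m(h) = magnetizationInField d β h = ⟨σ_0⟩⁺_{β,h}`,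
`u(z;h) = ⟨σ_{{0}∆{z}}⟩⁺_{β,h} − ⟨σ_0⟩⁺_{β,h}⟨σ_z⟩⁺_{β,h}` and `σ²(β,h) = Σ'_z u(z;h)` (the variance of the magnetisation
CLT of `IsingPositiveFieldCLT`, finite for `h > 0` by the GHS bound `≤ 4/(βh)`).

Ellis's Lemma V.7.4 (a) ("for `β > 0` and `h ≠ 0`, `χ(β,h) = ∂m/∂h` exists … and `χ = β σ²`") rests on the real
analyticity of the pressure in `h ≠ 0` (Lee–Yang, his Thm. V.4.4). Here everything EXCEPT that analytic input is
proved, by the route of his Lemma V.7.3 / (5.29)–(5.30) (Sokal 1981, App.) and convexity: the finite-volume plus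
magnetisations `f_L(h) = ⟨σ_0⟩⁺_{Λ_L;β,h}` are concave in `h ≥ 0` (GHS), converge to `m`, and `f_L' = β χ_L ↑ β σ²`
(monotone convergence in the volume, `PlusSusceptibilityVolumeLimit`); the chords of the limit are then sandwiched
(`ConcaveLimitSlopes`), and the right-continuity of `σ²(β,·)` closes the squeeze ON THE RIGHT at every `h`:

* `concaveOn_magnetizationInField` — **`h ↦ m(β,h)` is concave on `[0, ∞)`** (`β ≥ 0`; Friedli–Velenik Remark 3.41 /
  GHS 1970, in infinite volume), `monotoneOn_magnetizationInField`.
* `slope_magnetizationInField_le`, `le_slope_magnetizationInField` — **`β σ²(β,h') ≤ (m(h') − m(h))/(h' − h) ≤ β σ²(β,h)`**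
  for `0 ≤ h < h'` (the chord sandwich; the upper bound needs `σ²(β,h) < ∞`).
* **`hasDerivWithinAt_magnetizationInField_Ici`** — THE HEADLINE: for `β > 0` and every `h > 0` (and at `h = 0` whenever
  `σ²(β,0) < ∞`), `m(β,·)` has RIGHT DERIVATIVE `β σ²(β,h)` at `h`: `∂⁺m/∂h = β Σ_z ⟨σ_0;σ_z⟩⁺_{β,h}` — Ellis (5.28) for
  the right derivative, unconditionally.
* `hasDerivAt_magnetizationInField_of_continuousWithinAt` — `m` is differentiable at `h > 0` with `m'(h) = β σ²(β,h)` as soon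
  as `σ²(β,·)` is left-continuous at `h`; `deriv_magnetizationInField_eq` — wherever `m` is differentiable, `m' = βσ²`;
  `antitoneOn_tsum_plusTruncated`, **`countable_not_differentiableAt_magnetizationInField`** — `σ²(β,·)` is nonincreasing
  on `(0,∞)`, so `m(β,·)` is differentiable with `m' = β σ²` off a countable set of fields.
* AT `h = 0`: `hasDerivWithinAt_magnetizationInField_zero_of_lt_criticalBeta` — **`∂⁺m/∂h (β,0) = β χ(β)`** for
  `0 < β < β_c`, `d ≥ 2`, with `χ(β) = Σ_x ⟨σ_0σ_x⟩_β` the tree's `susceptibility` (the zero-field susceptibility IS the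
  field-derivative of the magnetisation), and the linear bound `magnetizationInField_le_mul_susceptibility`
  (`m(β,h) ≤ β χ(β) h`); `tendsto_slope_magnetizationInField_atTop_of_not_summable` — if `σ²(β,0) = ∞` then
  `(m(β,h) − m*(β))/h → ∞` as `h ↓ 0`; in particular **`tendsto_magnetizationInField_div_atTop_criticalBeta`**: at
  `β = β_c` (`d ≥ 2`, where `m*(β_c) = 0` and `χ(β_c) = ∞` are tree theorems) the critical isotherm has infinite initial
  slope, `m(β_c,h)/h → ∞`.

## References

* R. S. Ellis, *Entropy, Large Deviations, and Statistical Mechanics*, Springer (1985/2006), Lemma V.7.3, Lemma V.7.4,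
  eqs. (5.25)–(5.30), pp. 202–206. [Ellis2006]
* A. D. Sokal, *More inequalities for critical exponents*, J. Stat. Phys. 25 (1981) 25–50, Appendix. [SokalMoreInequalities1981]
* R. B. Griffiths, C. A. Hurst, S. Sherman, J. Math. Phys. 11 (1970) 790–795. [GriffithsHurstSherman1970]
* S. Friedli, Y. Velenik, *Statistical Mechanics of Lattice Systems*, CUP (2017), Lemma 3.31, Remark 3.41, Thm. 3.43,
  Exercise 3.34. [FriedliVelenik2017]
* M. Aizenman, D. J. Barsky, R. Fernández, J. Stat. Phys. 47 (1987) 343–374 (`χ(β_c) = ∞`). [AizenmanBarskyFernandezJSP1987]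
-/

noncomputable section

namespace Summit.CriticalPhenomena.PercolationContinuityZ3.Theorems.FK

namespace IsingSusceptibility

open MeasureTheory Filter Topology Finset Set
open scoped symmDiff
open Literature.Probability.LatticeModels
open Summit.CriticalPhenomena.PercolationContinuityZ3.Theorems.FK.IsingCLT
open Summit.CriticalPhenomena.PercolationContinuityZ3.Theorems.FK.ConcaveLimit

variable {d : ℕ}

/-! ### Concavity and monotonicity of `h ↦ m(β,h)` on `[0, ∞)` -/

/-- `m(β,h) = ⟨σ_{{0}}⟩⁺_{β,h}` and the finite-volume plus magnetisations converge to it: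
`⟨σ_{{0}}⟩⁺_{Λ_L;β,h} → m(β,h)` (`β ≥ 0`, every `h`). [cite: FriedliVelenik2017, Thm. 3.17 and §3.7.3] -/
theorem tendsto_isingCorr_plus_box_singleton_magnetizationInField {β : ℝ} (hβ : 0 ≤ β) (h : ℝ) :
    Tendsto (fun L : ℕ => isingCorr (zdGraph d) (box d L) β h .plus {0}) atTop (𝓝 (magnetizationInField d β h)) := by
  have hm : magnetizationInField d β h = plusCorr d β h {0} := by
    simp only [magnetizationInField, plusCorr, spinProduct_singleton]
  rw [hm]
  exact tendsto_isingCorr_plus_box hβ h {0}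

/-- **`h ↦ m(β,h)` IS CONCAVE ON `[0, ∞)`** (`β ≥ 0`): the GHS concavity of the finite-volume plus magnetisations
(`concaveOn_isingCorr_singleton`, Friedli–Velenik Remark 3.41) passes to the pointwise limit.
[cite: FriedliVelenik2017, Remark 3.41; GriffithsHurstSherman1970; Ellis2006, Thm. V.7.2 proof, (5.34)] -/
theorem concaveOn_magnetizationInField {β : ℝ} (hβ : 0 ≤ β) :
    ConcaveOn ℝ (Ici 0) (fun h => magnetizationInField d β h) :=
  concaveOn_of_tendsto (convex_Ici 0) (f := fun (L : ℕ) (t : ℝ) => isingCorr (zdGraph d) (box d L) β t .plus {0})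
    (fun L => concaveOn_isingCorr_singleton (zdGraph d) hβ (Or.inr rfl) (zero_mem_box d L))
    fun t _ => tendsto_isingCorr_plus_box_singleton_magnetizationInField hβ t

/-- **`h ↦ m(β,h)` is nondecreasing on `[0, ∞)`** (`β ≥ 0`; Griffiths / FKG). [cite: FriedliVelenik2017, Lemma 3.31 (1)] -/
theorem monotoneOn_magnetizationInField {β : ℝ} (hβ : 0 ≤ β) :
    MonotoneOn (fun h => magnetizationInField d β h) (Ici 0) := by
  intro a ha b _ hab
  have hm : ∀ t, magnetizationInField d β t = plusCorr d β t {0} := fun t => by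
    simp only [magnetizationInField, plusCorr, spinProduct_singleton]
  simp only [hm]
  exact plusCorr_mono_params hβ le_rfl ha hab {0}

/-! ### The chord sandwich `β σ²(β,h') ≤ (m(h') − m(h))/(h' − h) ≤ β σ²(β,h)` -/

/-- **Upper chord bound**: for `β > 0`, `0 ≤ h < h'` and `σ²(β,h) < ∞`,
`(m(h') − m(h))/(h' − h) ≤ β σ²(β,h) = β Σ'_z (⟨σ_{{0}∆{z}}⟩⁺_{β,h} − ⟨σ_0⟩⁺_{β,h}⟨σ_z⟩⁺_{β,h})`.
[cite: Ellis2006, Lemma V.7.4 (a), eqs. (5.29)–(5.30); SokalMoreInequalities1981, Appendix] -/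
theorem slope_magnetizationInField_le {β : ℝ} (hβ : 0 < β) {h h' : ℝ} (hh : 0 ≤ h) (hhh' : h < h')
    (hs : Summable fun z : Site d => plusCorr d β h ({0} ∆ {z}) - plusCorr d β h {0} * plusCorr d β h {z}) :
    slope (fun t => magnetizationInField d β t) h h' ≤
      β * ∑' z : Site d, (plusCorr d β h ({0} ∆ {z}) - plusCorr d β h {0} * plusCorr d β h {z}) :=
  slope_le_of_tendsto_deriv (S := Ici 0) (f := fun (L : ℕ) (t : ℝ) => isingCorr (zdGraph d) (box d L) β t .plus {0})
    (fun L => concaveOn_isingCorr_singleton (zdGraph d) hβ.le (Or.inr rfl) (zero_mem_box d L))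
    (fun t _ => tendsto_isingCorr_plus_box_singleton_magnetizationInField hβ.le t) (mem_Ici.2 hh)
    (fun L => hasDerivAt_isingCorr_plus_box_singleton_field β h L)
    ((tendsto_sum_isingCorrTrunc_plus_box hβ hh hs).const_mul β) (mem_Ici.2 (hh.trans hhh'.le)) hhh'

/-- **Lower chord bound**: for `β > 0`, `0 ≤ h < h'`, `β σ²(β,h') ≤ (m(h') − m(h))/(h' − h)` (here `σ²(β,h') < ∞`
automatically, `h' > 0`). [cite: Ellis2006, Lemma V.7.4 (a), eqs. (5.29)–(5.30); SokalMoreInequalities1981, Appendix] -/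
theorem le_slope_magnetizationInField {β : ℝ} (hβ : 0 < β) {h h' : ℝ} (hh : 0 ≤ h) (hhh' : h < h') :
    β * ∑' z : Site d, (plusCorr d β h' ({0} ∆ {z}) - plusCorr d β h' {0} * plusCorr d β h' {z}) ≤
      slope (fun t => magnetizationInField d β t) h h' :=
  have hh' : 0 < h' := hh.trans_lt hhh'
  le_slope_of_tendsto_deriv (S := Ici 0) (f := fun (L : ℕ) (t : ℝ) => isingCorr (zdGraph d) (box d L) β t .plus {0})
    (fun L => concaveOn_isingCorr_singleton (zdGraph d) hβ.le (Or.inr rfl) (zero_mem_box d L))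
    (fun t _ => tendsto_isingCorr_plus_box_singleton_magnetizationInField hβ.le t) (mem_Ici.2 hh'.le)
    (fun L => hasDerivAt_isingCorr_plus_box_singleton_field β h' L)
    ((tendsto_sum_isingCorrTrunc_plus_box hβ hh'.le (summable_plusTruncated_of_pos_field hβ hh')).const_mul β)
    (mem_Ici.2 hh) hhh'

/-- The upper chord bound in product form: `m(h') ≤ m(h) + β σ²(β,h) (h' − h)` for `0 ≤ h ≤ h'`, `σ²(β,h) < ∞`.
[cite: Ellis2006, Lemma V.7.4 (a)] -/
theorem magnetizationInField_le_add_mul {β : ℝ} (hβ : 0 < β) {h h' : ℝ} (hh : 0 ≤ h) (hhh' : h ≤ h')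
    (hs : Summable fun z : Site d => plusCorr d β h ({0} ∆ {z}) - plusCorr d β h {0} * plusCorr d β h {z}) :
    magnetizationInField d β h' ≤ magnetizationInField d β h +
      β * (∑' z : Site d, (plusCorr d β h ({0} ∆ {z}) - plusCorr d β h {0} * plusCorr d β h {z})) * (h' - h) := by
  rcases hhh'.eq_or_lt with rfl | hlt
  · simp
  have := slope_magnetizationInField_le (d := d) hβ hh hlt hs
  rw [slope_def_field, div_le_iff₀ (sub_pos.2 hlt)] at this
  linarith

/-- The lower chord bound in product form: `m(h) + β σ²(β,h') (h' − h) ≤ m(h')` for `0 ≤ h ≤ h'`, `0 < h'`.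
[cite: Ellis2006, Lemma V.7.4 (a)] -/
theorem add_mul_le_magnetizationInField {β : ℝ} (hβ : 0 < β) {h h' : ℝ} (hh : 0 ≤ h) (hhh' : h ≤ h') (hh' : 0 < h') :
    magnetizationInField d β h +
        β * (∑' z : Site d, (plusCorr d β h' ({0} ∆ {z}) - plusCorr d β h' {0} * plusCorr d β h' {z})) * (h' - h) ≤
      magnetizationInField d β h' := by
  rcases hhh'.eq_or_lt with rfl | hlt
  · simp
  have := le_slope_magnetizationInField (d := d) hβ hh hlt
  rw [slope_def_field, le_div_iff₀ (sub_pos.2 hlt)] at this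
  linarith

/-! ### THE FLUCTUATION–RESPONSE THEOREM: `∂⁺m/∂h = β σ²(β,h)` -/

/-- **ELLIS 2006, LEMMA V.7.4 / eq. (5.28), RIGHT-DERIVATIVE FORM — UNCONDITIONAL**: for the nearest-neighbour Ising
model on `ℤ^d` (every `d`), `β > 0`, and every `h ≥ 0` at which `σ²(β,h) = Σ'_z ⟨σ_0;σ_z⟩⁺_{β,h} < ∞` (e.g. every
`h > 0`), the magnetisation `m(β,·)` has RIGHT DERIVATIVE `β σ²(β,h)` at `h`:

`lim_{h'↓h} (m(β,h') − m(β,h))/(h' − h) = β Σ_{z∈ℤ^d} (⟨σ_0σ_z⟩⁺_{β,h} − ⟨σ_0⟩⁺_{β,h}⟨σ_z⟩⁺_{β,h})`.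

The chords are sandwiched between `β σ²(β,h')` and `β σ²(β,h)`, and `σ²(β,·)` is right-continuous
(`tendsto_tsum_plusTruncated_nhdsWithin_Ici`). [cite: Ellis2006, Lemma V.7.4 (a), eq. (5.28); SokalMoreInequalities1981, Appendix] -/
theorem hasDerivWithinAt_magnetizationInField_Ici {β : ℝ} (hβ : 0 < β) {h : ℝ} (hh : 0 ≤ h)
    (hs : Summable fun z : Site d => plusCorr d β h ({0} ∆ {z}) - plusCorr d β h {0} * plusCorr d β h {z}) :
    HasDerivWithinAt (fun t => magnetizationInField d β t)
      (β * ∑' z : Site d, (plusCorr d β h ({0} ∆ {z}) - plusCorr d β h {0} * plusCorr d β h {z})) (Ici h) h := by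
  rw [← hasDerivWithinAt_Ioi_iff_Ici]
  refine hasDerivWithinAt_Ioi_of_slope_squeeze
    (u := fun y => β * ∑' z : Site d, (plusCorr d β y ({0} ∆ {z}) - plusCorr d β y {0} * plusCorr d β y {z})) ?_ ?_ ?_
  · filter_upwards [self_mem_nhdsWithin] with y hy
    exact slope_magnetizationInField_le hβ hh hy hs
  · filter_upwards [self_mem_nhdsWithin] with y hy
    exact le_slope_magnetizationInField hβ hh hy
  · exact ((tendsto_tsum_plusTruncated_nhdsWithin_Ici hβ.le hh hs).mono_left
      (nhdsWithin_mono _ Ioi_subset_Ici_self)).const_mul β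

/-- **`∂⁺m/∂h (β,h) = β σ²(β,h)` at every `h > 0`** (`β > 0`; `σ²(β,h) ≤ 4/(βh) < ∞` by GHS,
`summable_plusTruncated_of_pos_field`). [cite: Ellis2006, Lemma V.7.4 (a), eq. (5.28)] -/
theorem hasDerivWithinAt_magnetizationInField_Ici_of_pos {β h : ℝ} (hβ : 0 < β) (hh : 0 < h) :
    HasDerivWithinAt (fun t => magnetizationInField d β t)
      (β * ∑' z : Site d, (plusCorr d β h ({0} ∆ {z}) - plusCorr d β h {0} * plusCorr d β h {z})) (Ici h) h :=
  hasDerivWithinAt_magnetizationInField_Ici hβ hh.le (summable_plusTruncated_of_pos_field hβ hh)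

/-- **Two-sided version**: if `σ²(β,·)` is also LEFT-continuous at `h > 0` (it is always right-continuous and
nonincreasing), then `m(β,·)` is differentiable at `h` with `m'(h) = β σ²(β,h)`. [cite: Ellis2006, Lemma V.7.4 (a)] -/
theorem hasDerivAt_magnetizationInField_of_continuousWithinAt {β h : ℝ} (hβ : 0 < β) (hh : 0 < h)
    (hc : ContinuousWithinAt
      (fun y => ∑' z : Site d, (plusCorr d β y ({0} ∆ {z}) - plusCorr d β y {0} * plusCorr d β y {z})) (Iio h) h) :
    HasDerivAt (fun t => magnetizationInField d β t)
      (β * ∑' z : Site d, (plusCorr d β h ({0} ∆ {z}) - plusCorr d β h {0} * plusCorr d β h {z})) h := by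
  refine hasDerivAt_of_slope_squeeze
    (u := fun y => β * ∑' z : Site d, (plusCorr d β y ({0} ∆ {z}) - plusCorr d β y {0} * plusCorr d β y {z}))
    (v := fun y => β * ∑' z : Site d, (plusCorr d β y ({0} ∆ {z}) - plusCorr d β y {0} * plusCorr d β y {z}))
    ?_ ?_ ?_ ?_ ?_ ?_
  · filter_upwards [self_mem_nhdsWithin] with y hy
    exact slope_magnetizationInField_le hβ hh.le hy (summable_plusTruncated_of_pos_field hβ hh)
  · filter_upwards [self_mem_nhdsWithin] with y hy
    exact le_slope_magnetizationInField hβ hh.le hy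
  · exact ((tendsto_tsum_plusTruncated_nhdsWithin_Ici hβ.le hh.le (summable_plusTruncated_of_pos_field hβ hh)).mono_left
      (nhdsWithin_mono _ Ioi_subset_Ici_self)).const_mul β
  · filter_upwards [Ioo_mem_nhdsLT hh] with y hy
    exact le_slope_magnetizationInField hβ hy.1.le hy.2
  · filter_upwards [Ioo_mem_nhdsLT hh] with y hy
    exact slope_magnetizationInField_le hβ hy.1.le hy.2 (summable_plusTruncated_of_pos_field hβ hy.1)
  · exact hc.tendsto.const_mul β

/-- **Wherever `m(β,·)` is differentiable at `h > 0`, `m'(h) = β σ²(β,h)`** (the right derivative is the only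
candidate). [cite: Ellis2006, Lemma V.7.4 (a), eq. (5.28)] -/
theorem deriv_magnetizationInField_eq {β h : ℝ} (hβ : 0 < β) (hh : 0 < h)
    (hd : DifferentiableAt ℝ (fun t => magnetizationInField d β t) h) :
    deriv (fun t => magnetizationInField d β t) h =
      β * ∑' z : Site d, (plusCorr d β h ({0} ∆ {z}) - plusCorr d β h {0} * plusCorr d β h {z}) :=
  deriv_eq_of_hasDerivWithinAt_Ioi
    ((hasDerivWithinAt_Ioi_iff_Ici).2 (hasDerivWithinAt_magnetizationInField_Ici_of_pos hβ hh)) hd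

/-- **`σ²(β,·)` is nonincreasing on `(0, ∞)`** (termwise GHS monotonicity, Ellis V.7.3 (b), summed).
[cite: Ellis2006, Lemma V.7.3 (b), eq. (5.27)] -/
theorem antitoneOn_tsum_plusTruncated {β : ℝ} (hβ : 0 < β) :
    AntitoneOn (fun y => ∑' z : Site d, (plusCorr d β y ({0} ∆ {z}) - plusCorr d β y {0} * plusCorr d β y {z}))
      (Ioi 0) := fun _ ha _ hb hab =>
  (summable_plusTruncated_of_pos_field hβ hb).tsum_le_tsum
    (fun z => plusTruncated_antitoneOn_field hβ.le 0 z (mem_Ici.2 (le_of_lt ha)) (mem_Ici.2 (le_of_lt hb)) hab)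
    (summable_plusTruncated_of_pos_field hβ ha)

/-- **`m(β,·)` IS DIFFERENTIABLE WITH `m' = β σ²` OFF A COUNTABLE SET OF FIELDS**: for `β > 0`, the set of `h > 0` at
which `h ↦ m(β,h)` is not differentiable is countable (it is contained in the discontinuity set of the monotone
function `σ²(β,·)`). [cite: Ellis2006, Lemma V.7.4 (a); Rockafellar1970, Thm. 25.3] -/
theorem countable_not_differentiableAt_magnetizationInField {β : ℝ} (hβ : 0 < β) :
    Set.Countable {h : ℝ | 0 < h ∧ ¬ DifferentiableAt ℝ (fun t => magnetizationInField d β t) h} := by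
  refine ((antitoneOn_tsum_plusTruncated (d := d) hβ).countable_not_continuousWithinAt).mono fun h hh => ?_
  refine ⟨hh.1, fun hc => hh.2 ?_⟩
  have hc' : ContinuousAt
      (fun y => ∑' z : Site d, (plusCorr d β y ({0} ∆ {z}) - plusCorr d β y {0} * plusCorr d β y {z})) h :=
    (continuousWithinAt_iff_continuousAt (Ioi_mem_nhds hh.1)).1 hc
  exact (hasDerivAt_magnetizationInField_of_continuousWithinAt hβ hh.1 hc'.continuousWithinAt).differentiableAt

/-! ### At `h = 0`: the zero-field susceptibility, the linear bound, and the critical isotherm -/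

/-- At `h = 0` and `β ≤ β_c` (`d ≥ 2`, where `m*(β) = 0` and the plus and free states coincide — tree theorems
`spontaneousMagnetization_eq_zero_of_le_criticalBeta_two_le`, `freeCorr_eq_plusCorr_of_le_criticalBeta`), the plus
truncated two-point function is the free two-point function: `u(z;0) = ⟨σ_0σ_z⟩^∅_{β}`.
[cite: FriedliVelenik2017, Thm. 3.25; AizenmanDuminilCopinSidoraviciusCMP2015, Thm. 1.2] -/
theorem plusTruncated_zero_field_eq_twoPointFree (hd : 2 ≤ d) {β : ℝ} (hβ : 0 ≤ β) (hβc : β ≤ criticalBeta d)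
    (z : Site d) :
    plusCorr d β 0 ({0} ∆ {z}) - plusCorr d β 0 {0} * plusCorr d β 0 {z} = twoPointFree d β z := by
  have hm : plusCorr d β 0 {0} = 0 := by
    rw [← spontaneousMagnetization_eq_plusCorr]
    exact spontaneousMagnetization_eq_zero_of_le_criticalBeta_two_le hd hβ hβc
  rw [hm, zero_mul, sub_zero, ← freeCorr_eq_plusCorr_of_le_criticalBeta hd hβ hβc, twoPointFree, freeCorr,
    spinPair_eq_spinProduct_symmDiff]

/-- Below `β_c` the zero-field sum is the susceptibility: `Σ'_z u(z;0) = χ(β) = (susceptibility d β).toReal`, and it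
converges (`0 ≤ β < β_c`, `d ≥ 2`; sharpness of the phase transition, Aizenman–Barsky–Fernández / Duminil-Copin–Tassion,
tree theorem `summable_twoPointFree_of_lt_criticalBeta`). [cite: AizenmanBarskyFernandezJSP1987, Thm. 1; FriedliVelenik2017, eq. (3.67)] -/
theorem summable_plusTruncated_zero_field_of_lt_criticalBeta (hd : 2 ≤ d) {β : ℝ} (hβ : 0 ≤ β)
    (hβc : β < criticalBeta d) :
    Summable (fun z : Site d => plusCorr d β 0 ({0} ∆ {z}) - plusCorr d β 0 {0} * plusCorr d β 0 {z}) ∧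
      ∑' z : Site d, (plusCorr d β 0 ({0} ∆ {z}) - plusCorr d β 0 {0} * plusCorr d β 0 {z}) =
        (susceptibility d β).toReal := by
  have hfun : (fun z : Site d => plusCorr d β 0 ({0} ∆ {z}) - plusCorr d β 0 {0} * plusCorr d β 0 {z}) =
      twoPointFree d β := funext fun z => plusTruncated_zero_field_eq_twoPointFree hd hβ hβc.le z
  rw [hfun]
  exact ⟨summable_twoPointFree_of_lt_criticalBeta hd hβ hβc,
    tsum_twoPointFree_eq_toReal_susceptibility hβ (summable_twoPointFree_of_lt_criticalBeta hd hβ hβc)⟩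

/-- **THE ZERO-FIELD SUSCEPTIBILITY IS THE FIELD-DERIVATIVE OF THE MAGNETISATION**: for `d ≥ 2` and `0 < β < β_c`,
`∂⁺m/∂h (β, 0) = β χ(β)`, `χ(β) = Σ_{x∈ℤ^d} ⟨σ_0σ_x⟩_β` (the tree's `susceptibility`, finite below `β_c`):
`HasDerivWithinAt (m(β,·)) (β χ(β)) [0,∞) 0`. (Ellis Lemma V.7.4 (b) in the finite case; Friedli–Velenik
Exercise 3.34.) [cite: Ellis2006, Lemma V.7.4 (b); FriedliVelenik2017, §3.7.4 eq. (3.67)] -/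
theorem hasDerivWithinAt_magnetizationInField_zero_of_lt_criticalBeta (hd : 2 ≤ d) {β : ℝ} (hβ : 0 < β)
    (hβc : β < criticalBeta d) :
    HasDerivWithinAt (fun t => magnetizationInField d β t) (β * (susceptibility d β).toReal) (Ici 0) 0 := by
  obtain ⟨hs, htsum⟩ := summable_plusTruncated_zero_field_of_lt_criticalBeta hd hβ.le hβc
  rw [← htsum]
  exact hasDerivWithinAt_magnetizationInField_Ici hβ le_rfl hs

/-- **The linear (mean-field-type) bound `m(β,h) ≤ β χ(β) h`** for `d ≥ 2`, `0 < β < β_c` and every `h ≥ 0`: the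
concave function `m(β,·)` lies below its tangent at `0`, where `m(β,0) = m*(β) = 0`.
[cite: Ellis2006, Lemma V.7.4; FriedliVelenik2017, §3.7.4] -/
theorem magnetizationInField_le_mul_susceptibility (hd : 2 ≤ d) {β : ℝ} (hβ : 0 < β) (hβc : β < criticalBeta d)
    {h : ℝ} (hh : 0 ≤ h) : magnetizationInField d β h ≤ β * (susceptibility d β).toReal * h := by
  obtain ⟨hs, htsum⟩ := summable_plusTruncated_zero_field_of_lt_criticalBeta hd hβ.le hβc
  have h0 : magnetizationInField d β 0 = 0 := by
    rw [magnetizationInField_zero]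
    exact spontaneousMagnetization_eq_zero_of_le_criticalBeta_two_le hd hβ.le hβc.le
  have := magnetizationInField_le_add_mul hβ le_rfl hh hs
  rw [htsum, h0, zero_add, sub_zero] at this
  exact this

/-- **If `σ²(β,0) = ∞` the magnetisation leaves `m*(β)` with infinite slope**: for `β > 0` and
`Σ_z (⟨σ_0σ_z⟩⁺_{β,0} − m*(β)⟨σ_z⟩⁺_{β,0}) = ∞`, `(m(β,h) − m(β,0))/h → ∞` as `h ↓ 0` (the lower chord bound and
`σ²(β,h) ↑ ∞`). [cite: Ellis2006, Lemma V.7.4 (b) ("all infinite together")] -/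
theorem tendsto_slope_magnetizationInField_atTop_of_not_summable {β : ℝ} (hβ : 0 < β)
    (hs : ¬ Summable fun z : Site d => plusCorr d β 0 ({0} ∆ {z}) - plusCorr d β 0 {0} * plusCorr d β 0 {z}) :
    Tendsto (fun h => slope (fun t => magnetizationInField d β t) 0 h) (𝓝[>] 0) atTop := by
  refine tendsto_atTop_mono' (𝓝[>] (0 : ℝ)) ?_
    ((tendsto_tsum_plusTruncated_atTop_of_not_summable hβ le_rfl hs).const_mul_atTop hβ)
  filter_upwards [self_mem_nhdsWithin] with h hh
  exact le_slope_magnetizationInField hβ le_rfl hh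

/-- **THE CRITICAL ISOTHERM HAS INFINITE INITIAL SLOPE**: for `d ≥ 2`, at `β = β_c` (where `m*(β_c) = 0` and
`χ(β_c) = ∞` are tree theorems: `spontaneousMagnetization_eq_zero_of_le_criticalBeta_two_le`,
`susceptibility_eq_top_of_criticalBeta_le`), `m(β_c, h)/h → ∞` as `h ↓ 0`.
[cite: AizenmanBarskyFernandezJSP1987, Thm. 1; Ellis2006, Lemma V.7.4 (b) and Thm. V.8.3 (d)] -/
theorem tendsto_magnetizationInField_div_atTop_criticalBeta (hd : 2 ≤ d) :
    Tendsto (fun h => magnetizationInField d (criticalBeta d) h / h) (𝓝[>] 0) atTop := by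
  have hβ : 0 < criticalBeta d := criticalBeta_pos_holds hd
  have hm0 : magnetizationInField d (criticalBeta d) 0 = 0 := by
    rw [magnetizationInField_zero]
    exact spontaneousMagnetization_eq_zero_of_le_criticalBeta_two_le hd hβ.le le_rfl
  -- `u(z;0) = ⟨σ_0σ_z⟩_{β_c}` is not summable since `χ(β_c) = ∞`
  have hfun : (fun z : Site d => plusCorr d (criticalBeta d) 0 ({0} ∆ {z}) -
      plusCorr d (criticalBeta d) 0 {0} * plusCorr d (criticalBeta d) 0 {z}) = twoPointFree d (criticalBeta d) :=
    funext fun z => plusTruncated_zero_field_eq_twoPointFree hd hβ.le le_rfl z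
  have hns : ¬ Summable fun z : Site d => plusCorr d (criticalBeta d) 0 ({0} ∆ {z}) -
      plusCorr d (criticalBeta d) 0 {0} * plusCorr d (criticalBeta d) 0 {z} := by
    rw [hfun]
    intro hsum
    have htop := susceptibility_eq_top_of_criticalBeta_le hd (le_refl (criticalBeta d))
    have h0 : ∀ z : Site d, 0 ≤ twoPointFree d (criticalBeta d) z := fun z => by
      rw [← plusTruncated_zero_field_eq_twoPointFree hd hβ.le le_rfl z]
      exact plusTruncated_nonneg hβ.le 0 0 z
    rw [susceptibility, ← ENNReal.ofReal_tsum_of_nonneg h0 hsum] at htop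
    exact ENNReal.ofReal_ne_top htop
  refine (tendsto_slope_magnetizationInField_atTop_of_not_summable hβ hns).congr' ?_
  filter_upwards [self_mem_nhdsWithin] with h hh
  rw [slope_def_field, hm0, sub_zero, sub_zero]

end IsingSusceptibility

end Summit.CriticalPhenomena.PercolationContinuityZ3.Theorems.FK

end
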